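/-
Copyright (c) 2026. All rights reserved.
Released under Apache 2.0 license as described in the file LICENSE.
Authors: HodgeCM publication cell (pub-hodgecm), model-construction sub-cell, discharge seat `mc-discharge-2`.
-/
import Literature.NumberTheory.GelbartRogawski1991.UnitaryDualPairSeesawDeepLevelFixed
import Literature.NumberTheory.GelbartRogawski1991.UnitaryDualPairSeesawConjMajorants
import HarnessLib

-- buildfix G11b-3 recipe (LEDGER B13-1/B13-3): elaborate sequentially so the trailing `attribute [implicit_reducible]`
-- block (reducibilityCoreExt is keyed to the async environment branch) is in force at `.olean` export.
set_option Elab.async false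

/-!
# Deep principal congruence levels of `U(J_V)(𝔸_{E,f})` fix `Φ_∞ ⊗ 𝟙_{x₀+𝔫𝒪̂}` under the renormalised small pairs
# of the CONJUGATED `(34)` torus

Topic `NumberTheory/GelbartRogawski1991`; namespace `Literature.NumberTheory.GelbartRogawski1991.UnitaryDualPair`.
KERNEL ONLY (0 definitions, 0 records, 0 named facts).  The `(34)`-currency twin of
`UnitaryDualPairSeesawDeepLevelFixed` (which treats the `(12)`-currency small pairs `twist charSmall_k (ω ∘ pairSmall_k s_k)`
over the block-sum splitting `seesawBigSum s`): here the big splitting is the CONJUGATED one, `seesawConjSum` (big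
splitting `s` conjugated by Weil's rational lift `ω(r_F h₀)` of the see-saw element and relabelled; data `g, C` of
`UnitaryDualPairSeesawSchemeSmall` §ThirtyFour), and the small representations are K-1's `seesawConjRep₁`
(`ω ∘ pairSmall₁ s₁` twisted by `(v,u₁) ↦ λ_V′ v · λ₃ u₁`) and `seesawConjRep₂` (`ω ∘ pairSmall₂ s₂` twisted by `λ₄`) of
`UnitaryDualPairSeesawThetaProduct`.  The CM instantiation (`cmLineRepRaw_k`, `cmLineRep_k η_k`, `cmLineRepFin_k η_k` of
`UnitaryDualPairSeesawCMLines`) is the sibling file `UnitaryDualPairSeesawCMLinesDeepLevelFixed`.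

* §0 (namespace `Literature.NumberTheory.Weil1964`, abstract product set-up `GV × (U₁ × U₂)` of
  `AdelicMetaplecticSeesawCharacter`): the engine of `UnitaryDualPairSeesawDeepLevelFixed` §0 RE-CUT with the continuity of
  the CHARACTER VALUES `g ↦ λ_V(g) ∈ ℂ` as hypothesis in place of the continuity of the big homomorphism `s`
  (**`exists_nat_forall_dvd_finCongruenceLevel_forall_twist_mpCharSmall₁_thinCosetTestFunₗ_eq_self_of_continuous`**) — the
  conjugated splitting carries no continuity statement for the coefficient topology of `Mp_ψ(W_𝔸)ᶜᵒⁿᵗ`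
  (`Weil1964/AdelicMetaplecticSeesawConjugate`), whereas K-1's division argument gives the continuity of `λ_V′` from Weil
  majorants (`continuous_charV₃₄` of `UnitaryDualPairSeesawConjMajorants`); the integer-level form of "a character continuous
  at `1` dies on a deep level" (`UnitaryGroup.exists_nat_forall_dvd_finCongruenceLevel_le_ker`); and the transport of
  thin-coset test functions under re-indexing, `R_e (Φ_∞ ⊗ 𝟙_{x₀+𝔫𝒪̂^ι}) = (R_e^∞ Φ_∞) ⊗ 𝟙_{x₀∘e⁻¹+𝔫𝒪̂^{ι′}}`
  (`piSBReindex_thinCosetTestFunₗ`, used by the sibling file's `Fin n₁` currency).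
* §1 (generic `(34)` data of record) **`exists_nat_forall_dvd_finCongruenceLevel_forall_seesawConjRep₁_thinCosetTestFunₗ_eq_self`**:
  for a continuous compatible `s₁`, `λ_V′` with continuous values, and a finite family of thin cosets there is `n₀ ≠ 0` such
  that for every non-zero multiple `M` of `n₀`, every `k ∈ K_{U,f}(M𝓞_E) ≤ U(J_V)(𝔸_{E,f})`, every `a` and EVERY `Φ_∞`:
  `ω₁″((1,k), 1) (Φ_∞ ⊗ 𝟙_{x₀(a)+𝔫(a)𝒪̂}) = Φ_∞ ⊗ 𝟙_{x₀(a)+𝔫(a)𝒪̂}`; its form **`…_of_hasThetaMajorants`** under the three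
  majorant hypotheses `hρ, hρ₁, hρ₂` of `hasThetaMajorants_seesawConjRep₁`; and **`…seesawConjRep₂…`** (only `s₂` continuous:
  `λ₄(1) = 1`).

USE (pub-hodgecm model layer, rows `S` / `C` / `real34`): the `(34)` reading of the finite factor of `ArchKTypeData.fixN` /
(Θ-sat) `sat` — the finite `K`-type `K₂ := K_{U,f}(M)` fixes every `φ_N(Φ_∞)` under the renormalised `(34)` small pairs.
Nothing here is a claim of the manuscripts under adjudication: kernel analysis over the tree's constructed objects; the
`IsCompatible` inputs are [GelbartRogawski1991, Prop. 3.1.1] instances, the majorant inputs are Weil's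
[Weil1964, n° 41 Lemme 5 / Thm 6 (1)].

References (provenance): S. Gelbart, J. Rogawski, Invent. Math. 105 (1991), §3.1 pp. 454–457; A. Weil, Acta Math.
111 (1964), Chap. III n° 37–41 pp. 187–194; R. Howe, *θ-series and invariant theory* (1979) §3; S. Kudla, *Seesaw dual
reductive pairs* (1984) §1; C. Mœglin, M.-F. Vignéras, J.-L. Waldspurger, LNM 1291 (1987), Chap. 2 I.3–I.4.
-/

set_option autoImplicit false

noncomputable section

open scoped Matrix Kronecker SchwartzMap Classical
open NumberField NumberField.mixedEmbedding IsDedekindDomain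
open Literature.RepresentationTheory
open Literature.NumberTheory.Automorphic
open Literature.NumberTheory.Automorphic.UnitaryGroup
open Literature.NumberTheory.Weil1964

namespace Literature.NumberTheory.Weil1964

/-! ## §0. Abstract engines -/

section Levels

variable {F₁ E : Type} [Field F₁] [Field E] [NumberField E] [Algebra F₁ E] {c : E ≃ₐ[F₁] E} {N : ℕ}
  {J : Matrix (Fin N) (Fin N) E}

/-- **Integer levels killing a character.** A homomorphism `χ : U(J)(𝔸_{E,f}) →* ℂˣ` continuous at `1` is trivial
on `K_{U,f}(M𝓞_E)` for every non-zero multiple `M` of some `n₀ ≠ 0` (`n₀ := N(𝔪)` for the ideal level `𝔪` of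
`UnitaryGroup.exists_finCongruenceLevel_le_ker`; `K_{U,f}(M𝓞_E) ≤ K_{U,f}(N(𝔪)𝓞_E) ≤ K_{U,f}(𝔪)`). [folklore] -/
theorem _root_.Literature.NumberTheory.Automorphic.UnitaryGroup.exists_nat_forall_dvd_finCongruenceLevel_le_ker
    (χ : UnitaryGroup.finAdelic F₁ E c N J →* ℂˣ) (hχ : ContinuousAt χ 1) :
    ∃ n₀ : ℕ, n₀ ≠ 0 ∧ ∀ M : ℕ, M ≠ 0 → n₀ ∣ M →
      ∀ k ∈ UnitaryGroup.finCongruenceLevel F₁ E c N J (Ideal.span {(M : 𝓞 E)}), χ k = 1 := by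
  have hex := UnitaryGroup.exists_finCongruenceLevel_le_ker χ hχ
  obtain ⟨𝔪, h𝔪, hker⟩ := hex
  refine ⟨Ideal.absNorm 𝔪, Ideal.absNorm_eq_zero_iff.not.2 (by rwa [← Ideal.zero_eq_bot]), fun M hM hdvd k hk => ?_⟩
  have hM0 : Ideal.span {(M : 𝓞 E)} ≠ 0 := by
    rw [Ne, Ideal.zero_eq_bot, Ideal.span_singleton_eq_bot]
    exact_mod_cast hM
  have hle : Ideal.span {(M : 𝓞 E)} ≤ Ideal.span {((Ideal.absNorm 𝔪 : ℕ) : 𝓞 E)} := by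
    rw [Ideal.span_singleton_le_span_singleton]
    exact Nat.cast_dvd_cast hdvd
  exact (MonoidHom.mem_ker).1
    (hker (UnitaryGroup.finCongruenceLevel_span_absNorm_le h𝔪 (UnitaryGroup.finCongruenceLevel_mono hM0 hle hk)))

end Levels

section Reindex

variable {K : Type} [Field K] [NumberField K] {ι ι' : Type} [Fintype ι] [Fintype ι']

/-- **Re-indexing transports thin-coset test functions**: `R_e (Φ_∞ ⊗ 𝟙_{x₀ + 𝔫𝒪̂^ι}) = (R_e^∞ Φ_∞) ⊗ 𝟙_{x₀∘e⁻¹ + 𝔫𝒪̂^{ι′}}`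
(`R_e Φ (w) = Φ (w ∘ e)`; the level box `(𝔫𝒪̂)^ι` is a product of identical factors). [folklore] -/
theorem piSBReindex_thinCosetTestFunₗ (e : ι ≃ ι') (x₀ : ι → FiniteAdeleRing (𝓞 K) K) (𝔫 : Ideal (𝓞 K))
    (Φ : 𝓢((ι → mixedSpace K), ℂ)) :
    piSBReindex K e (thinCosetTestFunₗ (K := K) (ι := ι) x₀ 𝔫 Φ) =
      thinCosetTestFunₗ (K := K) (ι := ι') (x₀ ∘ e.symm) 𝔫 (schwartzReindexCLM K e Φ) := by
  apply Subtype.ext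
  funext w
  rw [coe_piSBReindex_apply, coe_thinCosetTestFunₗ, coe_thinCosetTestFunₗ]
  have hmem : -x₀ + piFinite K ι (w ∘ e) ∈ piLevelIdeal K ι 𝔫 ↔
      -(x₀ ∘ e.symm) + piFinite K ι' w ∈ piLevelIdeal K ι' 𝔫 := by
    simp only [mem_piLevelIdeal_iff, Pi.add_apply, Pi.neg_apply, Function.comp_apply, piFinite_apply]
    exact ⟨fun h i' => by simpa only [Equiv.apply_symm_apply] using h (e.symm i'),
      fun h i => by simpa only [Equiv.symm_apply_apply] using h (e i)⟩
  by_cases hv : -x₀ + piFinite K ι (w ∘ e) ∈ piLevelIdeal K ι 𝔫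
  · rw [thinCosetTestFun_of_mem _ _ _ hv, thinCosetTestFun_of_mem _ _ _ (hmem.1 hv), schwartzReindexCLM_apply]
    rfl
  · rw [thinCosetTestFun_of_not_mem _ _ _ hv, thinCosetTestFun_of_not_mem _ _ _ fun h => hv (hmem.2 h)]

end Reindex

section SeesawSmall

variable {F : Type} [Field F] [NumberField F] {ι₁ ι₂ : Type} [Fintype ι₁] [DecidableEq ι₁] [Fintype ι₂]
  [DecidableEq ι₂] {T₁ : Matrix ι₁ ι₁ (AdeleRing (𝓞 F) F)} {T₂ : Matrix ι₂ ι₂ (AdeleRing (𝓞 F) F)}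
variable {GV U₁ U₂ : Type*} [Group GV] [Group U₁] [Group U₂] [TopologicalSpace GV] [TopologicalSpace U₁]
  (s : GV × (U₁ × U₂) →* adelicMpCont F (ι₁ ⊕ ι₂) (Matrix.fromBlocks T₁ 0 0 T₂))
  (s₁ : GV × U₁ →* adelicMpCont F ι₁ T₁) (s₂ : GV × U₂ →* adelicMpCont F ι₂ T₂)
  (hs : ∀ (g : GV) (u₁ : U₁) (u₂ : U₂),
    adelicMpCont.proj F (ι₁ ⊕ ι₂) (Matrix.fromBlocks T₁ 0 0 T₂) (s (g, (u₁, u₂))) =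
      UnitaryGroup.spSum T₁ T₂
        (adelicMpCont.proj F ι₁ T₁ (s₁ (g, u₁)), adelicMpCont.proj F ι₂ T₂ (s₂ (g, u₂))))
  (hT₁ : IsUnit T₁) (hT₂ : IsUnit T₂)
variable {F₁ E : Type} [Field F₁] [Field E] [NumberField E] [Algebra F₁ E] {c : E ≃ₐ[F₁] E} {N : ℕ}
  {J : Matrix (Fin N) (Fin N) E}

/-- **Deep principal congruence levels fix `Φ_∞ ⊗ 𝟙_{x₀+𝔫𝒪̂}` under the renormalised first small pair — character-value
form.** In the product see-saw set-up of `AdelicMetaplecticSeesawCharacter` (ANY homomorphisms `s, s₁, s₂` of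
`GV × (U₁ × U₂)`, `GV × U₁`, `GV × U₂` over `π`; `T₁, T₂` invertible) assume: `s₁` is continuous, the values
`g ↦ λ_V(g) ∈ ℂ` of the first see-saw factor character are continuous, and `ιV : U(J)(𝔸_{E,f}) →* GV` is a continuous
homomorphism whose points have symplectic components `π(s₁(ιV k, 1))` fixing the archimedean vectors (`harch`). Then for
every finite family of thin cosets there is `n₀ ≠ 0` such that for every non-zero multiple `M` of `n₀`, every
`k ∈ K_{U,f}(M𝓞_E)`, every `a` and every `Φ_∞`, the renormalised small representation `ω₁′ = twist (λ_V ⊠ λ₁) (ω ∘ s₁)`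
FIXES `Φ_∞ ⊗ 𝟙_{x₀(a)+𝔫(a)𝒪̂^{ι₁}}` at `(ιV k, 1)` (no continuity of the big homomorphism `s` is used: this is the form
needed when `s` is a conjugate by a non-pointwise operator).
[cite: GelbartRogawski1991, §3.1 p. 454, Remark p. 457; Weil1964, Chap. III n° 37–39 pp. 187–190] -/
theorem exists_nat_forall_dvd_finCongruenceLevel_forall_twist_mpCharSmall₁_thinCosetTestFunₗ_eq_self_of_continuous
    (hc₁ : Continuous s₁) (hχ : Continuous fun g : GV => (mpCharV s s₁ s₂ hs hT₁ hT₂ g : ℂ))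
    (ιV : UnitaryGroup.finAdelic F₁ E c N J →* GV) (hι : Continuous ιV)
    (harch : ∀ (k : UnitaryGroup.finAdelic F₁ E c N J) (a w : ι₁ → mixedSpace F),
      (adelicMpCont.proj F ι₁ T₁ (s₁ (ιV k, 1))).1 (archVec F ι₁ a, archVec F ι₁ w) =
        (archVec F ι₁ a, archVec F ι₁ w))
    {A : Type*} [Finite A] (x₀ : A → ι₁ → FiniteAdeleRing (𝓞 F) F) (𝔫 : A → Ideal (𝓞 F)) :
    ∃ n₀ : ℕ, n₀ ≠ 0 ∧ ∀ M : ℕ, M ≠ 0 → n₀ ∣ M →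
      ∀ k ∈ UnitaryGroup.finCongruenceLevel F₁ E c N J (Ideal.span {(M : 𝓞 E)}),
        ∀ a, ∀ Φ : 𝓢((ι₁ → mixedSpace F), ℂ),
          SeesawScalar.twist (mpCharSmall₁ s s₁ s₂ hs hT₁ hT₂) ((adelicMpCont.omega F ι₁ T₁).comp s₁) (ιV k, 1)
              (thinCosetTestFunₗ (K := F) (ι := ι₁) (x₀ a) (𝔫 a) Φ) =
            thinCosetTestFunₗ (K := F) (ι := ι₁) (x₀ a) (𝔫 a) Φ := by
  -- the small splitting and the twist character read on `U(J)(𝔸_{E,f})` along `k ↦ (ιV k, 1)`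
  let e : UnitaryGroup.finAdelic F₁ E c N J →* GV × U₁ := (MonoidHom.inl GV U₁).comp ιV
  have he : Continuous e := (hι.prodMk continuous_const : Continuous fun k => (ιV k, (1 : U₁)))
  have hs' : Continuous (s₁.comp e) := hc₁.comp he
  have hχval : Continuous fun k => ((mpCharSmall₁ s s₁ s₂ hs hT₁ hT₂).comp e k : ℂ) := by
    have h : (fun k => ((mpCharSmall₁ s s₁ s₂ hs hT₁ hT₂).comp e k : ℂ)) =
        (fun g : GV => (mpCharV s s₁ s₂ hs hT₁ hT₂ g : ℂ)) ∘ ιV := by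
      funext k
      simp only [Function.comp_apply, MonoidHom.comp_apply, e, MonoidHom.inl_apply, mpCharSmall₁_apply_eq_mul,
        map_one, mul_one]
    rw [h]
    exact hχ.comp hι
  have hχ₁ : ContinuousAt ((mpCharSmall₁ s s₁ s₂ hs hT₁ hT₂).comp e) 1 :=
    (((mpCharSmall₁ s s₁ s₂ hs hT₁ hT₂).comp e).continuous_of_continuous_units_val hχval).continuousAt
  have hex := exists_nat_forall_dvd_finCongruenceLevel_forall_omega_thinCosetTestFunₗ_eq_self hT₁ (s₁.comp e) hs'
    (fun k a w => harch k a w) ((mpCharSmall₁ s s₁ s₂ hs hT₁ hT₂).comp e) hχ₁ x₀ 𝔫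
  obtain ⟨n₀, hn₀, h⟩ := hex
  refine ⟨n₀, hn₀, fun M hM hdvd k hk a Φ => ?_⟩
  have hk' := ((h M hM hdvd k hk).2 a Φ).2
  rwa [show ((adelicMpCont.omega F ι₁ T₁).comp (s₁.comp e)) = ((adelicMpCont.omega F ι₁ T₁).comp s₁).comp e from
    rfl, twist_comp_apply] at hk'

end SeesawSmall

end Literature.NumberTheory.Weil1964

namespace Literature.NumberTheory.GelbartRogawski1991

namespace UnitaryDualPair

/-! ## §1. The conjugated `(34)` torus at the splitting data of record -/

section ThirtyFour

variable (F E : Type) [Field F] [NumberField F] [Field E] [NumberField E] [Algebra F E]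
variable (c : E ≃ₐ[F] E) (N M₁ M₂ : ℕ) {n n₁ n₂ : ℕ} (eW : Fin N × Fin (M₁ + M₂) ≃ Fin n)
  (e₁ : Fin N × Fin M₁ ≃ Fin n₁) (e₂ : Fin N × Fin M₂ ≃ Fin n₂)
variable (JV : Matrix (Fin N) (Fin N) E) (JW : Matrix (Fin (M₁ + M₂)) (Fin (M₁ + M₂)) E)
  (J₁ : Matrix (Fin M₁) (Fin M₁) E) (J₂ : Matrix (Fin M₂) (Fin M₂) E)
variable {TV : Matrix (Fin N) (Fin N) F} {TW : Matrix (Fin (M₁ + M₂)) (Fin (M₁ + M₂)) F}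
  {T₁ : Matrix (Fin M₁) (Fin M₁) F} {T₂ : Matrix (Fin M₂) (Fin M₂) F}
variable [Algebra.IsQuadraticExtension F E] {δ : E} (hcδ : c δ = -δ) (hδ : δ ≠ 0) {d : F}
  (hd : δ * δ = algebraMap F E d) (hV : TV.IsSymm) (hW : TW.IsSymm) (h₁ : T₁.IsSymm) (h₂ : T₂.IsSymm)
  (hVd : IsUnit TV.det) (hTWd : IsUnit TW.det) (h₁d : IsUnit T₁.det) (h₂d : IsUnit T₂.det)
  (hT : IsUnit (TV.map (algebraMap F (AdeleRing (𝓞 F) F)) ⊗ₖ TW.map (algebraMap F (AdeleRing (𝓞 F) F))).det)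
  (hJV : JV = TV.map (algebraMap F E)) (hJW : JW = TW.map (algebraMap F E))
  (hJ₁ : J₁ = T₁.map (algebraMap F E)) (hJ₂ : J₂ = T₂.map (algebraMap F E))
  {s : adelicPair F E c N (M₁ + M₂) JV JW →* adelicMpCont F (Fin n) (adelicGram F eW TV TW)}
  {s₁ : adelicPair F E c N M₁ JV J₁ →* adelicMpCont F (Fin n₁) (adelicGram F e₁ TV T₁)}
  {s₂ : adelicPair F E c N M₂ JV J₂ →* adelicMpCont F (Fin n₂) (adelicGram F e₂ TV T₂)}
  {g : GL (Fin (M₁ + M₂)) (AdeleRing (𝓞 E) E)} {g₀ : GL (Fin (M₁ + M₂)) E}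
  (hgg₀ : (g : Matrix (Fin (M₁ + M₂)) (Fin (M₁ + M₂)) (AdeleRing (𝓞 E) E)) =
    ((g₀ : GL (Fin (M₁ + M₂)) E) : Matrix (Fin (M₁ + M₂)) (Fin (M₁ + M₂)) E).map (algebraMap E (AdeleRing (𝓞 E) E)))
  (hg : ((g : Matrix (Fin (M₁ + M₂)) (Fin (M₁ + M₂)) (AdeleRing (𝓞 E) E)).map (conjAdele F E c))ᵀ *
      adelicForm E (M₁ + M₂) JW * g = adelicForm E (M₁ + M₂) (finSum M₁ M₂ J₁ J₂))
  {C : GL (Fin N × Fin (M₁ + M₂)) (AdeleRing (𝓞 F) F)} {C₀ : GL (Fin N × Fin (M₁ + M₂)) F}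
  (hCC₀ : (C : Matrix (Fin N × Fin (M₁ + M₂)) (Fin N × Fin (M₁ + M₂)) (AdeleRing (𝓞 F) F)) =
    ((C₀ : GL (Fin N × Fin (M₁ + M₂)) F) : Matrix (Fin N × Fin (M₁ + M₂)) (Fin N × Fin (M₁ + M₂)) F).map
      (algebraMap F (AdeleRing (𝓞 F) F)))
  (hC : TV.map (algebraMap F (AdeleRing (𝓞 F) F)) ⊗ₖ TW.map (algebraMap F (AdeleRing (𝓞 F) F)) *
      (C : Matrix (Fin N × Fin (M₁ + M₂)) (Fin N × Fin (M₁ + M₂)) (AdeleRing (𝓞 F) F)) =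
    TV.map (algebraMap F (AdeleRing (𝓞 F) F)) ⊗ₖ (finSum M₁ M₂ T₁ T₂).map (algebraMap F (AdeleRing (𝓞 F) F)))
  (hs : (splittingDatum F E c N (M₁ + M₂) eW JV JW hcδ hδ hd hV hW hVd hTWd hJV hJW).IsCompatible s)
  (hs₁ : (splittingDatum F E c N M₁ e₁ JV J₁ hcδ hδ hd hV h₁ hVd h₁d hJV hJ₁).IsCompatible s₁)
  (hs₂ : (splittingDatum F E c N M₂ e₂ JV J₂ hcδ hδ hd hV h₂ hVd h₂d hJV hJ₂).IsCompatible s₂)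

/-! Weil's majorant hypotheses for the big pair `ω ∘ s_pair` and the two small pairs `ω ∘ pairSmall_j s_j` (verbatim the
hypotheses of `UnitaryDualPairSeesawConjMajorants.hasThetaMajorants_seesawConjRep₁/₂`). -/
variable
  (hρ : HasThetaMajorants fun (p : adelic F E c N JV × adelic F E c (M₁ + M₂) JW) (Φ : piSchwartzBruhat F (Fin n)) =>
    pairRep F E c N (M₁ + M₂) eW JV JW s p Φ)
  (hρ₁ : HasThetaMajorants fun (p : adelic F E c N JV × adelic F E c M₁ J₁) (Φ : piSchwartzBruhat F (Fin N × Fin M₁)) =>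
    (adelicMpCont.omega F (Fin N × Fin M₁)
      (TV.map (algebraMap F (AdeleRing (𝓞 F) F)) ⊗ₖ T₁.map (algebraMap F (AdeleRing (𝓞 F) F))))
      (pairSmall₁ F E c N M₁ e₁ JV J₁ s₁ p) Φ)
  (hρ₂ : HasThetaMajorants fun (p : adelic F E c N JV × adelic F E c M₂ J₂) (Φ : piSchwartzBruhat F (Fin N × Fin M₂)) =>
    (adelicMpCont.omega F (Fin N × Fin M₂)
      (TV.map (algebraMap F (AdeleRing (𝓞 F) F)) ⊗ₖ T₂.map (algebraMap F (AdeleRing (𝓞 F) F))))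
      (pairSmall₂ F E c N M₂ e₂ JV J₂ s₂ p) Φ)

/-- **Conjugated `(34)` torus, first small pair, at the data of record.** For a continuous compatible `s₁`, the see-saw
character `λ_V′` of the conjugated torus with CONTINUOUS VALUES, and a finite family of thin cosets there is `n₀ ≠ 0`
such that for every non-zero multiple `M` of `n₀`, every `k ∈ K_{U,f}(M𝓞_E) ≤ U(J_V)(𝔸_{E,f})`, every `a` and every
`Φ_∞`: K-1's renormalised small representation `ω₁″ = seesawConjRep₁` (`ω ∘ pairSmall₁ s₁` twisted by
`(v,u₁) ↦ λ_V′ v · λ₃ u₁`) fixes `Φ_∞ ⊗ 𝟙_{x₀(a)+𝔫(a)𝒪̂}` at `((1,k), 1)`.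
[cite: GelbartRogawski1991, §3.1 p. 454, Remark p. 457; Weil1964, Chap. III n° 37–39 pp. 187–190] -/
theorem exists_nat_forall_dvd_finCongruenceLevel_forall_seesawConjRep₁_thinCosetTestFunₗ_eq_self
    (hc₁ : Continuous (pairSplitting F E c N M₁ e₁ JV J₁ s₁))
    (hχ : Continuous fun v : adelic F E c N JV =>
      (charV₃₄ F E c N M₁ M₂ eW e₁ e₂ JV JW J₁ J₂ hcδ hδ hd hV hW h₁ h₂ hVd hTWd h₁d h₂d hT hJV hJW hJ₁ hJ₂ hgg₀ hg hCC₀ hC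
        hs hs₁ hs₂ v : ℂ))
    {A : Type*} [Finite A] (x₀ : A → Fin N × Fin M₁ → FiniteAdeleRing (𝓞 F) F) (𝔫 : A → Ideal (𝓞 F)) :
    ∃ n₀ : ℕ, n₀ ≠ 0 ∧ ∀ M : ℕ, M ≠ 0 → n₀ ∣ M →
      ∀ k ∈ finCongruenceLevel F E c N JV (Ideal.span {(M : 𝓞 E)}), ∀ a, ∀ Φ : 𝓢((Fin N × Fin M₁ → mixedSpace F), ℂ),
        seesawConjRep₁ F E c N M₁ M₂ eW e₁ e₂ JV JW J₁ J₂ hcδ hδ hd hV hW h₁ h₂ hVd hTWd h₁d h₂d hT hJV hJW hJ₁ hJ₂ hgg₀ hg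
            hCC₀ hC hs hs₁ hs₂ (finAdelicToAdelic F E c N JV k, 1)
            (thinCosetTestFunₗ (K := F) (ι := Fin N × Fin M₁) (x₀ a) (𝔫 a) Φ) =
          thinCosetTestFunₗ (K := F) (ι := Fin N × Fin M₁) (x₀ a) (𝔫 a) Φ :=
  exists_nat_forall_dvd_finCongruenceLevel_forall_twist_mpCharSmall₁_thinCosetTestFunₗ_eq_self_of_continuous
    (seesawConjSum F E c N M₁ M₂ eW JV JW J₁ J₂ hcδ hδ hd hV hW h₁ h₂ hVd hTWd hT hJV hJW hJ₁ hJ₂ hgg₀ hg hCC₀ hC (s := s))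
    (pairSmall₁ F E c N M₁ e₁ JV J₁ s₁) (pairSmall₂ F E c N M₂ e₂ JV J₂ s₂)
    (hs₃_seesawConj F E c N M₁ M₂ eW e₁ e₂ JV JW J₁ J₂ hcδ hδ hd hV hW h₁ h₂ hVd hTWd h₁d h₂d hT hJV hJW hJ₁ hJ₂ hgg₀ hg
      hCC₀ hC hs hs₁ hs₂)
    (isUnit_kronecker_map F N hVd h₁d) (isUnit_kronecker_map F N hVd h₂d)
    (continuous_pairSmall₁ F E c N M₁ e₁ JV J₁ hc₁) hχ (finAdelicToAdelic F E c N JV)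
    (continuous_finAdelicToAdelic F E c N JV)
    (fun k a w => proj_pairSmall₁_finAdelic_one_apply_archVec F E c N M₁ e₁ JV J₁ hcδ hδ hd hV h₁ hVd h₁d hJV hJ₁ hs₁ k a w)
    x₀ 𝔫

include hρ hρ₁ hρ₂ in
/-- **The same under Weil's majorants** of the big pair `ω ∘ s_pair` and of the two small pairs `ω ∘ pairSmall_j s_j`
(the hypotheses of `hasThetaMajorants_seesawConjRep₁`): then `λ_V′` has continuous values (`continuous_charV₃₄`, the
division argument on the see-saw identity of theta kernels), so for continuous compatible `s₁` deep integer levels of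
`U(J_V)(𝔸_{E,f})` fix every `Φ_∞ ⊗ 𝟙_{x₀(a)+𝔫(a)𝒪̂}` under `ω₁″ = seesawConjRep₁` at `((1,k), 1)`.
[cite: GelbartRogawski1991, §3.1 p. 454, Remark p. 457; Weil1964, Chap. III n° 41 Thm 6 p. 193] -/
theorem exists_nat_forall_dvd_finCongruenceLevel_forall_seesawConjRep₁_thinCosetTestFunₗ_eq_self_of_hasThetaMajorants
    (hc₁ : Continuous (pairSplitting F E c N M₁ e₁ JV J₁ s₁))
    {A : Type*} [Finite A] (x₀ : A → Fin N × Fin M₁ → FiniteAdeleRing (𝓞 F) F) (𝔫 : A → Ideal (𝓞 F)) :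
    ∃ n₀ : ℕ, n₀ ≠ 0 ∧ ∀ M : ℕ, M ≠ 0 → n₀ ∣ M →
      ∀ k ∈ finCongruenceLevel F E c N JV (Ideal.span {(M : 𝓞 E)}), ∀ a, ∀ Φ : 𝓢((Fin N × Fin M₁ → mixedSpace F), ℂ),
        seesawConjRep₁ F E c N M₁ M₂ eW e₁ e₂ JV JW J₁ J₂ hcδ hδ hd hV hW h₁ h₂ hVd hTWd h₁d h₂d hT hJV hJW hJ₁ hJ₂ hgg₀ hg
            hCC₀ hC hs hs₁ hs₂ (finAdelicToAdelic F E c N JV k, 1)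
            (thinCosetTestFunₗ (K := F) (ι := Fin N × Fin M₁) (x₀ a) (𝔫 a) Φ) =
          thinCosetTestFunₗ (K := F) (ι := Fin N × Fin M₁) (x₀ a) (𝔫 a) Φ :=
  exists_nat_forall_dvd_finCongruenceLevel_forall_seesawConjRep₁_thinCosetTestFunₗ_eq_self F E c N M₁ M₂ eW e₁ e₂ JV JW
    J₁ J₂ hcδ hδ hd hV hW h₁ h₂ hVd hTWd h₁d h₂d hT hJV hJW hJ₁ hJ₂ hgg₀ hg hCC₀ hC hs hs₁ hs₂ hc₁
    (continuous_charV₃₄ F E c N M₁ M₂ eW e₁ e₂ JV JW J₁ J₂ hcδ hδ hd hV hW h₁ h₂ hVd hTWd h₁d h₂d hT hJV hJW hJ₁ hJ₂ hgg₀ hg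
      hCC₀ hC hs hs₁ hs₂ hρ hρ₁ hρ₂) x₀ 𝔫

/-- **Conjugated `(34)` torus, second small pair, at the data of record** (the `k = 1` line): for a continuous compatible
`s₂` (and the data `s, s₁, g, C` of the conjugated see-saw) and a finite family of thin cosets there is `n₀ ≠ 0` such that
for every non-zero multiple `M` of `n₀`, every `k ∈ K_{U,f}(M𝓞_E) ≤ U(J_V)(𝔸_{E,f})`, every `a` and every `Φ_∞`: K-1's
`ω₂″ = seesawConjRep₂` (`ω ∘ pairSmall₂ s₂` twisted by `λ₄`; `λ₄(1) = 1`) fixes `Φ_∞ ⊗ 𝟙_{x₀(a)+𝔫(a)𝒪̂}` at `((1,k), 1)` —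
no majorant or character hypothesis.
[cite: GelbartRogawski1991, §3.1 p. 454, Remark p. 457; Weil1964, Chap. III n° 37–39 pp. 187–190] -/
theorem exists_nat_forall_dvd_finCongruenceLevel_forall_seesawConjRep₂_thinCosetTestFunₗ_eq_self
    (hc₂ : Continuous (pairSplitting F E c N M₂ e₂ JV J₂ s₂))
    {A : Type*} [Finite A] (x₀ : A → Fin N × Fin M₂ → FiniteAdeleRing (𝓞 F) F) (𝔫 : A → Ideal (𝓞 F)) :
    ∃ n₀ : ℕ, n₀ ≠ 0 ∧ ∀ M : ℕ, M ≠ 0 → n₀ ∣ M →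
      ∀ k ∈ finCongruenceLevel F E c N JV (Ideal.span {(M : 𝓞 E)}), ∀ a, ∀ Φ : 𝓢((Fin N × Fin M₂ → mixedSpace F), ℂ),
        seesawConjRep₂ F E c N M₁ M₂ eW e₁ e₂ JV JW J₁ J₂ hcδ hδ hd hV hW h₁ h₂ hVd hTWd h₁d h₂d hT hJV hJW hJ₁ hJ₂ hgg₀ hg
            hCC₀ hC hs hs₁ hs₂ (finAdelicToAdelic F E c N JV k, 1)
            (thinCosetTestFunₗ (K := F) (ι := Fin N × Fin M₂) (x₀ a) (𝔫 a) Φ) =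
          thinCosetTestFunₗ (K := F) (ι := Fin N × Fin M₂) (x₀ a) (𝔫 a) Φ :=
  exists_nat_forall_dvd_finCongruenceLevel_forall_twist_mpCharSmall₂_thinCosetTestFunₗ_eq_self
    (seesawConjSum F E c N M₁ M₂ eW JV JW J₁ J₂ hcδ hδ hd hV hW h₁ h₂ hVd hTWd hT hJV hJW hJ₁ hJ₂ hgg₀ hg hCC₀ hC (s := s))
    (pairSmall₁ F E c N M₁ e₁ JV J₁ s₁) (pairSmall₂ F E c N M₂ e₂ JV J₂ s₂)
    (hs₃_seesawConj F E c N M₁ M₂ eW e₁ e₂ JV JW J₁ J₂ hcδ hδ hd hV hW h₁ h₂ hVd hTWd h₁d h₂d hT hJV hJW hJ₁ hJ₂ hgg₀ hg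
      hCC₀ hC hs hs₁ hs₂)
    (isUnit_kronecker_map F N hVd h₁d) (isUnit_kronecker_map F N hVd h₂d)
    (continuous_pairSmall₂ F E c N M₂ e₂ JV J₂ hc₂) (finAdelicToAdelic F E c N JV) (continuous_finAdelicToAdelic F E c N JV)
    (fun k a w => proj_pairSmall₂_finAdelic_one_apply_archVec F E c N M₂ e₂ JV J₂ hcδ hδ hd hV h₂ hVd h₂d hJV hJ₂ hs₂ k a w)
    x₀ 𝔫

end ThirtyFour

/-! ### Build-lane note (ops-buildfix G11b-3 recipe, LEDGER B13-1, 2026-08-21)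
`lean -o` (the hub build lane, never `lean`/the gate check) runs Lean 4.32's library-suggestion indexers
(`Lean.LibrarySuggestions.SymbolFrequency` / `SineQuaNon`, from their `exportEntriesFn`) over the statement of
every local theorem that is not a denied premise; on this family's statements (very large dependent binder
telescopes through the theta-kernel / dual-pair data) that fold runs for tens of minutes to hours and the build
lane kills the job (incident G11b-3, run/shared/lean/ops/buildfix/G11b-3-DOSSIER.md). `isDeniedPremise` skips
`[implicit_reducible]` constants before any fold, and a reducibility status on a *theorem* is inert (Meta never
unfolds `thmInfo`; the kernel ignores the attribute), so the public theorems of this file are tagged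
`[implicit_reducible]` purely to keep them out of that index. Only other effect: they are not offered by
`+suggestions` premise selectors. No statement or proof is changed; superseded if the operator lands a
deny-list form (`HarnessLib.PremiseIndex`). -/
set_option allowUnsafeReducibility true in
attribute [implicit_reducible]

  _root_.Literature.NumberTheory.Automorphic.UnitaryGroup.exists_nat_forall_dvd_finCongruenceLevel_le_ker
  _root_.Literature.NumberTheory.Weil1964.piSBReindex_thinCosetTestFunₗ
  _root_.Literature.NumberTheory.Weil1964.exists_nat_forall_dvd_finCongruenceLevel_forall_twist_mpCharSmall₁_thinCosetTestFunₗ_eq_self_of_continuous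
  exists_nat_forall_dvd_finCongruenceLevel_forall_seesawConjRep₁_thinCosetTestFunₗ_eq_self
  exists_nat_forall_dvd_finCongruenceLevel_forall_seesawConjRep₁_thinCosetTestFunₗ_eq_self_of_hasThetaMajorants
  exists_nat_forall_dvd_finCongruenceLevel_forall_seesawConjRep₂_thinCosetTestFunₗ_eq_self

end UnitaryDualPair

end Literature.NumberTheory.GelbartRogawski1991

end
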